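/-
Copyright: statement-level skeleton of a published paper (lit-balaban cell, Phase-2 proof seat p39 gen 13). No proof claims
beyond what the kernel checks below.
-/
import Literature.Probability.Distributions.GaussianWickTheorem
import Literature.MathematicalPhysics.QuantumFieldTheory.Balaban1983to89.B3WTFreeWick

/-!
# B3 — T. Bałaban, *(Higgs)₂,₃ quantum fields in a finite volume. III. Renormalization*, CMP **88** (1983) 411–445
[Balaban1983Higgs3], p. 414 [PDF 4] and p. 430 [PDF 20]: **THE CONTRACTION OF LEGS INTO PROPAGATORS (WICK'S THEOREM) FOR THE
LATTICE GAUSSIAN FIELDS** — the Gaussian integral of a product of any number of legs is the sum over the divisions of the legs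
into pairs of the products of the propagators of the pairs, and vanishes for an odd number of legs

statement-level skeleton of published theorems with citation tags; proofs where landed; nothing here is a claim about
the Yang–Mills mass gap

PDF held: `paper:balaban1983-higgs-2-3-quantum-fields-finite-volume` (journal page = PDF page + 410); pp. 414–415 [PDF 4–5] and
pp. 430–431 [PDF 20–21] read on the ×4 renders
`run/shared/lean/pub/pub-balaban/b2b-balaban-ref1/pages/1983-cmp88-higgs23-III/1983-cmp88-higgs23-III-p004-x4.png`, `…-p020-x4.png`.

CITATION HEADER (lean-in-tree rule).  Part of the lit-balaban TYPED SKELETON (HOME `run/shared/lean/pub/lit-balaban/`), PHASE 2,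
proof seat p39 (generation 13).  Rows **B3.Eq1.17-1.18** (the graph notion, pp. 414–415) and **B3.Eq2.26-2.28** ((2.26)–(2.28),
p. 431: "calculating the Gaussian integrals") of `HOME/lit-balaban-r15/ROWS-B3.md` (fold owner r15).  This is the B3 instance
file of the general theorem `Literature/Probability/Distributions/GaussianWickTheorem` (this seat, same generation: Wick's theorem
of general order for centred Gaussian processes, `GaussianWick.integral_prod_eq_pairingSum`, and the Gaussian integration by parts
`GaussianWick.integral_mul_prod_eq_sum`), applied to the Gaussian measures this seat constructed for the paper: the Gaussian field
`gaussianFieldOfKernel K` of a positive semidefinite kernel (file `CurvatureGaussianField`; its finitely supported linear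
functionals `B3WTFreeMeasure.linF`, Gram form `gram`), the colour-diagonal lattice fields `B3WTFreeWick.kernelMeasure d N C`
(kernel `δ_{ab}C(x − y)`; field insertions `⟪φ(x), v⟫ = B3WTFreeWick.fld`), and the free measure `dμ_{C^η_{M²}}`
(`B3WTFreeMeasure.freeMeasure` = the instance `C = C^η_{M²}` = `B3WT226FreeLattice.CetaM`).  The pairing sum is the tree's
`Literature.Probability.LatticeModels.pairingSum` ("Wick's law with covariance `S₂`").  Up to now the tree had these Gaussian
integrals for two and four legs only (`B3WTFreeMeasure.integral_linF_mul₄`, `B3WTFreeWick.integral_inner4K`, the torus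
`B3WTWick.moment4`).

THE PRINTED TEXT (verbatim).  p. 414 [PDF 4]: *"Now we can describe an arbitrary expression in the expansion. It consists of a
number of vertices. … All the A′-legs are contracted, i.e. they are divided into pairs and each pair is replaced by the
corresponding propagator. Some φ′-legs are replaced by external scalar fields and the remaining are again divided into pairs and
each pair is replaced by a propagator, i.e. by G_k(Ω, B), G_k(Ω₂, B), δG_k(Ω, Ω₂, B) or the operator (1.16). Of course the whole
expression is multiplied by a proper combinatorial factor connected with the number of ways given expression can be obtained
from Gaussian integrals in (1.5)."*  p. 430 [PDF 20]: *"Now differentiating (2.24) with respect to A, connecting the vertices by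
properly localized propagators, and calculating the Gaussian integrals [F(φ) is chosen as a polynomial …], we get a set of
Ward-Takahashi identities."*  The mathematical content of "divided into pairs and each pair is replaced by the corresponding
propagator" is Wick's theorem for the centred Gaussian measure whose covariance is the propagator ([Janson1997] Thm 1.28,
[GlimmJaffeQP1987] (8.2.4)): `∫ ∏_{i<2k} leg_i dμ = ∑_{pairings} ∏_{pairs {i,j}} ∫ leg_i leg_j dμ`, and `∫ ∏_{i<2k+1} leg_i dμ = 0`.

WHAT IS PROVED (theorems only).
* §1 (any index type `ι`, any positive semidefinite kernel `K`, the field `gaussianFieldOfKernel K`): `isGaussianProcess_linF` (the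
  legs `L_c = Σ_{s∈S} c(s)ω(s)` form a centred Gaussian process indexed by the coefficient vectors), **`integral_prod_eval_eq_pairingSum`**
  (`∫ ∏_{i<2k} ω(x_i) dμ_K = pairingSum K k x` — each pair replaced by the propagator `K`), `integral_prod_eval_odd`,
  `integral_eval_mul_prod_eval` (integration by parts: `∫ ω(a)∏_{j∈s}ω(y_j) = Σ_{j∈s} K(a, y_j) ∫ ∏_{i∈s∖j} ω(y_i)`),
  **`integral_prod_linF_eq_pairingSum`** (`∫ ∏_{i<2k} L_{c_i} dμ_K = pairingSum (gram K S) k c`), `integral_prod_linF_odd`,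
  `integral_linF_mul_prod_linF`.
* §2 (the lattice fields of the paper: `kernelMeasure d N C` for a positive semidefinite colour-diagonal kernel, in particular the free
  measure `dμ_{C^η_{M²}}`, `η > 0`, `M² > 0`): `isGaussianProcess_inner_fld` (the field insertions `⟪φ(x), v⟫` form a centred Gaussian
  process indexed by `(x, v)`), **`integral_prod_inner_fld_eq_pairingSum`** (`∫ ∏_{i<2k} ⟪φ(x_i), v_i⟫ dμ_C =
  Σ_{pairings} ∏_{pairs} C(x_i − x_j)⟪v_i, v_j⟫`), `integral_prod_inner_fld_odd`, `integral_inner_fld_mul_prod` (the first-leg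
  recursion), and the free instances `integral_prod_inner_fld_free`, `integral_prod_inner_fld_free_odd` (propagator `C^η_{M²}`).
HONEST SCOPE: Gaussian integrals of products of legs (the contraction rule); the graph bookkeeping of pp. 414–415 (vertices,
external fields, combinatorial factors) is r15's typed carrier `B3Sect1Statements`/`B3Prop1` and is not re-typed here; the torus
measures of `B3WT223Instance` (density form) are not treated here (their order-4 Wick lemma is `B3WTWick.moment4`).  Mathlib + the
cited tree files only; theorems, no definition, no named fact, no `sorry`; standard axioms.  Unit `lit-balaban-p39-g13` (Phase-2
proof seat p39, gen 13), HOME `run/shared/lean/pub/lit-balaban/`, 2026-08-22.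

References: [Balaban1983Higgs3] T. Bałaban, CMP 88 (1983) 411–445, pp. 414–415, 430–431; [Janson1997] S. Janson, *Gaussian Hilbert
Spaces* (1997), Thm 1.28, Rem. 1.29; [GlimmJaffeQP1987] J. Glimm, A. Jaffe, *Quantum Physics* (2nd ed. 1987), Thm 6.3.1, §8.2
(8.2.1)–(8.2.4).
-/

noncomputable section

open scoped BigOperators InnerProductSpace
open MeasureTheory ProbabilityTheory Finset

namespace Literature.MathematicalPhysics.QuantumFieldTheory.Balaban1983to89.B3GaussianContractions

open Literature.MathematicalPhysics.QuantumFieldTheory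
open Literature.Probability.LatticeModels (pairingSum pairingSum_congr_of_eq)
open Literature.Probability.Distributions
open B3Sect3VectorSelfEnergy (ZSite)
open B3WTFreeMeasure B3WTFreeWick B3WT226FreeLattice

/-! ## §1 The Gaussian field of a positive semidefinite kernel: coordinates and finitely supported linear functionals -/

section Kernel

variable {ι : Type} [DecidableEq ι] {K : ι → ι → ℝ}

/-- **contraction of coordinate legs**: for the Gaussian field `dμ_K` of a positive semidefinite kernel `K` and any `2k`
coordinates `x_i` (repetitions allowed), `∫ ∏_{i<2k} ω(x_i) dμ_K = Σ_{pairings} ∏_{pairs} K(x_i, x_j)` — "divided into pairs and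
each pair is replaced by the corresponding propagator". [cite: Balaban1983Higgs3, p.414 (PDF p.4), contraction of legs]
[cite: Janson1997, Thm 1.28 (1.2)] -/
theorem integral_prod_eval_eq_pairingSum (hK : IsPosSemidefKernel K) (k : ℕ) (x : Fin (2 * k) → ι) :
    ∫ ω, ∏ i, ω (x i) ∂gaussianFieldOfKernel K = pairingSum K k x := by
  rw [GaussianWick.integral_prod_eq_pairingSum (isGaussianProcess_eval_gaussianFieldOfKernel hK)
    (integral_eval_gaussianFieldOfKernel hK) k x]
  exact pairingSum_congr_of_eq _ _ k x x fun i j => integral_eval_mul hK (x i) (x j)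

/-- an odd number of coordinate legs integrates to zero. [cite: Balaban1983Higgs3, p.414 (PDF p.4), contraction of legs]
[cite: Janson1997, Rem. 1.29] -/
theorem integral_prod_eval_odd (hK : IsPosSemidefKernel K) (k : ℕ) (x : Fin (2 * k + 1) → ι) :
    ∫ ω, ∏ i, ω (x i) ∂gaussianFieldOfKernel K = 0 :=
  GaussianWick.integral_prod_odd_eq_zero (isGaussianProcess_eval_gaussianFieldOfKernel hK)
    (integral_eval_gaussianFieldOfKernel hK) k x

/-- **Gaussian integration by parts for coordinate legs** (contract the distinguished leg `ω(a)` with each of the others):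
`∫ ω(a)∏_{j∈s} ω(y_j) dμ_K = Σ_{j∈s} K(a, y_j) ∫ ∏_{i∈s∖{j}} ω(y_i) dμ_K`. [cite: GlimmJaffeQP1987, Thm 6.3.1 (6.3.3) and §8.2 (8.2.1)]
[cite: Balaban1983Higgs3, p.430 (PDF p.20), «connecting the vertices by … propagators, and calculating the Gaussian integrals»] -/
theorem integral_eval_mul_prod_eval (hK : IsPosSemidefKernel K) (a : ι) {κ : Type*} [DecidableEq κ] (s : Finset κ)
    (y : κ → ι) :
    ∫ ω, ω a * ∏ j ∈ s, ω (y j) ∂gaussianFieldOfKernel K =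
      ∑ j ∈ s, K a (y j) * ∫ ω, ∏ i ∈ s.erase j, ω (y i) ∂gaussianFieldOfKernel K := by
  rw [GaussianWick.integral_mul_prod_eq_sum (isGaussianProcess_eval_gaussianFieldOfKernel hK)
    (integral_eval_gaussianFieldOfKernel hK) a s y]
  exact Finset.sum_congr rfl fun j _ => by rw [integral_eval_mul hK]

/-- **the legs `L_c = Σ_{s∈S} c(s)ω(s)` (finitely supported linear functionals: lattice derivatives `∂^ηφ`, block averages `Q_kφ`,
smeared fields) form a centred Gaussian process indexed by the coefficient vectors** (a linear image of the coordinate process).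
[cite: Janson1997, Thm 1.28 (centred jointly normal variables)] -/
theorem isGaussianProcess_linF (hK : IsPosSemidefKernel K) (S : Finset ι) :
    IsGaussianProcess (fun (c : ι → ℝ) (ω : ι → ℝ) => linF S c ω) (gaussianFieldOfKernel K) := by
  refine (isGaussianProcess_eval_gaussianFieldOfKernel hK).of_isGaussianProcess fun c => ⟨S,
    ∑ s ∈ S.attach, c s • (ContinuousLinearMap.proj s : (↥S → ℝ) →L[ℝ] ℝ), fun ω => ?_⟩
  simp [linF, Finset.restrict_def]
  exact (Finset.sum_attach S fun s => c s * ω s).symm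

/-- **contraction of linear-functional legs**: `∫ ∏_{i<2k} L_{c_i} dμ_K = Σ_{pairings} ∏_{pairs} G(c_i, c_j)`, `G = gram K S` the pair
expectation `∫ L_{c_i}L_{c_j} dμ_K` — Wick's theorem of general order for the legs of the field (the tree had `k = 2`,
`B3WTFreeMeasure.integral_linF_mul₄`). [cite: Balaban1983Higgs3, p.414 (PDF p.4), contraction of legs] [cite: Janson1997, Thm 1.28 (1.2)] -/
theorem integral_prod_linF_eq_pairingSum (hK : IsPosSemidefKernel K) (S : Finset ι) (k : ℕ) (c : Fin (2 * k) → ι → ℝ) :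
    ∫ ω, ∏ i, linF S (c i) ω ∂gaussianFieldOfKernel K = pairingSum (gram K S) k c := by
  rw [GaussianWick.integral_prod_eq_pairingSum (isGaussianProcess_linF hK S) (integral_linF hK S) k c]
  exact pairingSum_congr_of_eq _ _ k c c fun i j => integral_linF_mul_linF hK S (c i) (c j)

/-- an odd number of linear-functional legs integrates to zero. [cite: Balaban1983Higgs3, p.414 (PDF p.4), contraction of legs]
[cite: Janson1997, Rem. 1.29] -/
theorem integral_prod_linF_odd (hK : IsPosSemidefKernel K) (S : Finset ι) (k : ℕ) (c : Fin (2 * k + 1) → ι → ℝ) :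
    ∫ ω, ∏ i, linF S (c i) ω ∂gaussianFieldOfKernel K = 0 :=
  GaussianWick.integral_prod_odd_eq_zero (isGaussianProcess_linF hK S) (integral_linF hK S) k c

/-- **Gaussian integration by parts for linear-functional legs**: `∫ L_a ∏_{j∈s} L_{c_j} dμ_K = Σ_{j∈s} G(a, c_j) ∫ ∏_{i∈s∖{j}} L_{c_i} dμ_K`.
[cite: GlimmJaffeQP1987, Thm 6.3.1 (6.3.3) and §8.2 (8.2.1)] [cite: Janson1997, Thm 1.28 (proof)] -/
theorem integral_linF_mul_prod_linF (hK : IsPosSemidefKernel K) (S : Finset ι) (a : ι → ℝ) {κ : Type*} [DecidableEq κ]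
    (s : Finset κ) (c : κ → ι → ℝ) :
    ∫ ω, linF S a ω * ∏ j ∈ s, linF S (c j) ω ∂gaussianFieldOfKernel K =
      ∑ j ∈ s, gram K S a (c j) * ∫ ω, ∏ i ∈ s.erase j, linF S (c i) ω ∂gaussianFieldOfKernel K := by
  rw [GaussianWick.integral_mul_prod_eq_sum (isGaussianProcess_linF hK S) (integral_linF hK S) a s c]
  exact Finset.sum_congr rfl fun j _ => by rw [integral_linF_mul_linF hK]

end Kernel

/-! ## §2 The lattice fields of the paper: field insertions `⟪φ(x), v⟫` under `dμ_C` and `dμ_{C^η_{M²}}` -/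

section Lattice

variable {d N : ℕ} {Cf : ZSite d → ℝ} {η M2 : ℝ}

/-- **the field insertions `⟪φ(x), v⟫` form a centred Gaussian process indexed by `(x, v)`** under the Gaussian field `dμ_C` of a
positive semidefinite colour-diagonal kernel `δ_{ab}C(x − y)` (a linear image of the coordinate process). [cite: Balaban1983Higgs3, (2.25)–(2.26) p.431] -/
theorem isGaussianProcess_inner_fld (hK : IsPosSemidefKernel (scalarKernel d N Cf)) :
    IsGaussianProcess (fun (p : ZSite d × EuclideanSpace ℝ (Fin N)) (ω : Cfg d N) => ⟪fld ω p.1, p.2⟫_ℝ)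
      (kernelMeasure d N Cf) := by
  classical
  refine (isGaussianProcess_kernelMeasure hK).of_isGaussianProcess fun p => ?_
  refine ⟨({p.1} : Finset (ZSite d)) ×ˢ (Finset.univ : Finset (Fin N)),
    ∑ a : Fin N, p.2 a • (ContinuousLinearMap.proj ⟨(p.1, a), by simp⟩ :
      (↥(({p.1} : Finset (ZSite d)) ×ˢ (Finset.univ : Finset (Fin N))) → ℝ) →L[ℝ] ℝ), fun ω => ?_⟩
  simp [inner_fld_eq_sum, Finset.restrict_def, mul_comm]

/-- the insertions are centred: `∫⟪φ(x), v⟫dμ_C = 0`. [cite: Balaban1983Higgs3, (2.25) p.431] -/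
theorem integral_inner_fld (hK : IsPosSemidefKernel (scalarKernel d N Cf)) (x : ZSite d) (v : EuclideanSpace ℝ (Fin N)) :
    ∫ ω, ⟪fld ω x, v⟫_ℝ ∂kernelMeasure d N Cf = 0 := by
  have hx : x ∈ ({x} : Finset (ZSite d)) := Finset.mem_singleton_self x
  simp_rw [inner_fld_eq_linF hx]
  exact integral_linF hK _ _

/-- **contraction of field insertions (Wick's theorem of general order for the lattice scalar field)**: for any `2k` legs
`⟪φ(x_i), v_i⟫`, `∫ ∏_{i<2k} ⟪φ(x_i), v_i⟫ dμ_C = Σ_{pairings} ∏_{pairs {i,j}} C(x_i − x_j)⟪v_i, v_j⟫` — "divided into pairs and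
each pair is replaced by the corresponding propagator" (the tree had `k = 1, 2`: `B3WTFreeWick.integral_inner_fld_inner_fldK`,
`integral_inner4K`). [cite: Balaban1983Higgs3, p.414 (PDF p.4), contraction of legs; p.430 (PDF p.20) «calculating the Gaussian integrals»]
[cite: Janson1997, Thm 1.28 (1.2)] -/
theorem integral_prod_inner_fld_eq_pairingSum (hK : IsPosSemidefKernel (scalarKernel d N Cf)) (k : ℕ)
    (x : Fin (2 * k) → ZSite d) (v : Fin (2 * k) → EuclideanSpace ℝ (Fin N)) :
    ∫ ω, ∏ i, ⟪fld ω (x i), v i⟫_ℝ ∂kernelMeasure d N Cf =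
      pairingSum (fun p q : ZSite d × EuclideanSpace ℝ (Fin N) => Cf (p.1 - q.1) * ⟪p.2, q.2⟫_ℝ) k (fun i => (x i, v i)) := by
  have h := GaussianWick.integral_prod_eq_pairingSum (isGaussianProcess_inner_fld hK)
    (fun p => integral_inner_fld hK p.1 p.2) k (fun i => (x i, v i))
  dsimp only at h
  rw [h]
  exact pairingSum_congr_of_eq _ _ k _ _ fun i j => integral_inner_fld_inner_fldK hK (x i) (x j) (v i) (v j)

/-- an odd number of field insertions integrates to zero (a loop of scalar lines with an odd number of legs).
[cite: Balaban1983Higgs3, p.414 (PDF p.4), contraction of legs] [cite: Janson1997, Rem. 1.29] -/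
theorem integral_prod_inner_fld_odd (hK : IsPosSemidefKernel (scalarKernel d N Cf)) (k : ℕ)
    (x : Fin (2 * k + 1) → ZSite d) (v : Fin (2 * k + 1) → EuclideanSpace ℝ (Fin N)) :
    ∫ ω, ∏ i, ⟪fld ω (x i), v i⟫_ℝ ∂kernelMeasure d N Cf = 0 := by
  have h := GaussianWick.integral_prod_odd_eq_zero (isGaussianProcess_inner_fld hK)
    (fun p => integral_inner_fld hK p.1 p.2) k (fun i => (x i, v i))
  dsimp only at h
  exact h

/-- **the first-leg recursion for field insertions** (Gaussian integration by parts: contract `⟪φ(x₀), v₀⟫` with each other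
leg): `∫ ⟪φ(x₀),v₀⟫ ∏_{j∈s} ⟪φ(y_j),u_j⟫ dμ_C = Σ_{j∈s} C(x₀ − y_j)⟪v₀,u_j⟫ ∫ ∏_{i∈s∖{j}} ⟪φ(y_i),u_i⟫ dμ_C`.
[cite: Balaban1983Higgs3, p.430 (PDF p.20), «connecting the vertices by … propagators, and calculating the Gaussian integrals»]
[cite: GlimmJaffeQP1987, Thm 6.3.1 (6.3.3) and §8.2 (8.2.1)] -/
theorem integral_inner_fld_mul_prod (hK : IsPosSemidefKernel (scalarKernel d N Cf)) (x₀ : ZSite d)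
    (v₀ : EuclideanSpace ℝ (Fin N)) {κ : Type*} [DecidableEq κ] (s : Finset κ) (y : κ → ZSite d)
    (u : κ → EuclideanSpace ℝ (Fin N)) :
    ∫ ω, ⟪fld ω x₀, v₀⟫_ℝ * ∏ j ∈ s, ⟪fld ω (y j), u j⟫_ℝ ∂kernelMeasure d N Cf =
      ∑ j ∈ s, Cf (x₀ - y j) * ⟪v₀, u j⟫_ℝ * ∫ ω, ∏ i ∈ s.erase j, ⟪fld ω (y i), u i⟫_ℝ ∂kernelMeasure d N Cf := by
  have h := GaussianWick.integral_mul_prod_eq_sum (isGaussianProcess_inner_fld hK)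
    (fun p => integral_inner_fld hK p.1 p.2) (x₀, v₀) s (fun j => (y j, u j))
  dsimp only at h
  rw [h]
  exact Finset.sum_congr rfl fun j _ => by rw [integral_inner_fld_inner_fldK hK]

/-- **the free instance**: under `dμ_{C^η_{M²}}` at free boundary conditions (`η > 0`, `M² > 0`) each pair of scalar legs is
replaced by the propagator `C^η_{M²}`: `∫ ∏_{i<2k} ⟪φ(x_i), v_i⟫ dμ_{C^η_{M²}} = Σ_{pairings} ∏_{pairs} C^η_{M²}(x_i − x_j)⟪v_i, v_j⟫`.
[cite: Balaban1983Higgs3, (2.26)–(2.27) p.431 («where now the propagators are C^η_{M²}»)] [cite: Janson1997, Thm 1.28 (1.2)] -/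
theorem integral_prod_inner_fld_free (hη : 0 < η) (hM : 0 < M2) (k : ℕ) (x : Fin (2 * k) → ZSite d)
    (v : Fin (2 * k) → EuclideanSpace ℝ (Fin N)) :
    ∫ ω, ∏ i, ⟪fld ω (x i), v i⟫_ℝ ∂freeMeasure d N η M2 =
      pairingSum (fun p q : ZSite d × EuclideanSpace ℝ (Fin N) => CetaM d η M2 (p.1 - q.1) * ⟪p.2, q.2⟫_ℝ) k
        (fun i => (x i, v i)) := by
  rw [freeMeasure_eq_kernelMeasure]
  exact integral_prod_inner_fld_eq_pairingSum
    (freeKernel_eq_scalarKernel d N η M2 ▸ isPosSemidefKernel_freeKernel hη hM) k x v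

/-- the free instance, odd number of legs: `∫ ∏_{i<2k+1} ⟪φ(x_i), v_i⟫ dμ_{C^η_{M²}} = 0`.
[cite: Balaban1983Higgs3, (2.25)–(2.26) p.431] [cite: Janson1997, Rem. 1.29] -/
theorem integral_prod_inner_fld_free_odd (hη : 0 < η) (hM : 0 < M2) (k : ℕ) (x : Fin (2 * k + 1) → ZSite d)
    (v : Fin (2 * k + 1) → EuclideanSpace ℝ (Fin N)) :
    ∫ ω, ∏ i, ⟪fld ω (x i), v i⟫_ℝ ∂freeMeasure d N η M2 = 0 := by
  rw [freeMeasure_eq_kernelMeasure]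
  exact integral_prod_inner_fld_odd (freeKernel_eq_scalarKernel d N η M2 ▸ isPosSemidefKernel_freeKernel hη hM) k x v

end Lattice

end Literature.MathematicalPhysics.QuantumFieldTheory.Balaban1983to89.B3GaussianContractions

end
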